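import Summits.HubbardSuperconductivity.HubbardSuperconductivity.Theorems.AposterioriCapRgDefs
import Literature.MathematicalPhysics.QuantumLattice.XYOrderDischarges
import Literature.MathematicalPhysics.QuantumLattice.GroundStateSourceBounds

/-!
# `XYOrderOpennessLargeSpin`, line `feynman-sector-gap`: the Fourier budget (`stub_fourierBudget`)

Crux item stmt-HubbardSuperconductivity-13895 (route `AposterioriCapRg`), vocabulary of
`Theorems/AposterioriCapRgDefs.lean`. For `W = Σ_x w_x` a sum of Hermitian rules with spectrum in
`[-1, 1]` (`NormBoundedRuleSum`), `H = hpert L n W ε = xyTorus 2 L n + εW` on the torus `(ℤ/Lℤ)²` of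
side `L ≥ 3`, `S = n/2`, and the tracial ground state `ω` of `H`:

`S² L⁴ - |ε| L⁴ ≤ orderSum L n H + Σ_{q ≠ 0} C_H(q)`,  `C_H(q) = modeWeight L n H q`.

Proof (Kennedy–Lieb–Shastry, PRL 61 (1988) 2582, eqs. (2)–(3) and the variational remark after
eq. (8), made reflection-positivity-free and `ε`-robust):
1. Parseval on `(ℤ/Lℤ)²`: `e^{-ip·x} = conj χ_q(x)` for the characters `χ_q(z) = ∏ⱼ e(qⱼzⱼ)`
   (`torusChar_eq_exp`), so `Σ_q Ŝ^αᴴ_q Ŝ^α_q = Σ_{x,y} (Σ_q χ_q(x - y)) S^α_x S^α_y = L² Σ_x (S^α_x)²`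
   (`sum_torusChar`); at `q = 0` the mode is the total spin, so `C_H(0) = orderSum`. Hence the right
   side equals `L² Σ_x Re ω((S⁰_x)² + (S¹_x)²)`.
2. `E₀ = Re ω(H)` with `H = -Σ_edges (b⁰ + b¹) + εW`; the operator AM–GM
   `b^α_{xy} ≤ ½((S^α_x)² + (S^α_y)²)` (`(S_x - S_y)ᴴ(S_x - S_y) ≥ 0`), positivity of `ω` and the
   `4`-regularity of the torus graph (edge sums are site–direction sums, `sum_pairs_eq_sum_edgeFinset`)
   give `-Re ω(xyTorus) ≤ 2 Σ_x Re ω((S⁰_x)² + (S¹_x)²)`, and `|Re ω(W)| ≤ L²` since `-1 ≤ w_x ≤ 1`.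
3. The planar product state has energy `-S²·#edges + ε⟨W⟩ ≤ -2S²L² + |ε|L²`
   (`xyTorus_trialEnergy`, `groundEnergy_le_rayleigh_holds`), whence
   `Σ_x Re ω((S⁰_x)² + (S¹_x)²) ≥ S²L² - |ε|L²`.
-/

noncomputable section

namespace Summit.HubbardSuperconductivity.HubbardSuperconductivity.Theorems.XYOrderOpennessLargeSpin

set_option linter.dupNamespace false -- summit = problem name (single-conjunct summit), D-0017

open Matrix Complex Finset
open scoped ComplexOrder
open Literature.MathematicalPhysics.QuantumLattice Literature.Probability.LatticeModels

/-! ### Parseval on `(ℤ/Lℤ)²` for the spin modes -/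

/-- `e^{-i p·x} = conj χ_q(x)`, `χ_q(x) = ∏ⱼ e(qⱼ xⱼ)` the character of `(ℤ/Lℤ)²`. [folklore] -/
private theorem exp_neg_phase_eq_star (L : ℕ) [NeZero L] (q x : TorusSite 2 L) :
    cexp (-(I * (torusPhase L q x : ℂ))) = star (∏ j, (ZMod.stdAddChar (q j * x j) : ℂ)) := by
  rw [torusChar_eq_exp, Complex.star_def, ← Complex.exp_conj, map_mul, Complex.conj_ofReal,
    Complex.conj_I]
  congr 1
  ring

/-- `conj e^{-i p·x} = χ_q(x)`. [folklore] -/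
private theorem star_exp_neg_phase (L : ℕ) [NeZero L] (q x : TorusSite 2 L) :
    star (cexp (-(I * (torusPhase L q x : ℂ)))) = ∏ j, (ZMod.stdAddChar (q j * x j) : ℂ) := by
  rw [exp_neg_phase_eq_star, star_star]

/-- `(Ŝ^α_q)ᴴ = Σ_x χ_q(x) S^α_x`. [folklore] -/
private theorem spinMode_conjTranspose (L : ℕ) [NeZero L] (n : ℕ) (q : TorusSite 2 L)
    (α : Fin 3) :
    (spinMode L n q α)ᴴ = ∑ x, (∏ j, (ZMod.stdAddChar (q j * x j) : ℂ)) • siteSpin n x α := by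
  unfold spinMode
  rw [conjTranspose_sum]
  refine sum_congr rfl fun x _ => ?_
  rw [conjTranspose_smul, (siteSpin_isHermitian n x α).eq, star_exp_neg_phase]

/-- `(Ŝ^α_q)ᴴ Ŝ^α_q = Σ_{x,y} χ_q(x - y) S^α_x S^α_y`. [folklore] -/
private theorem spinMode_conjTranspose_mul (L : ℕ) [NeZero L] (n : ℕ) (q : TorusSite 2 L)
    (α : Fin 3) :
    (spinMode L n q α)ᴴ * spinMode L n q α =
      ∑ x, ∑ y, (∏ j, (ZMod.stdAddChar (q j * (x - y) j) : ℂ)) •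
        (siteSpin n x α * siteSpin n y α) := by
  rw [spinMode_conjTranspose]
  unfold spinMode
  rw [sum_mul_sum]
  refine sum_congr rfl fun x _ => sum_congr rfl fun y _ => ?_
  rw [smul_mul_smul_comm, exp_neg_phase_eq_star, ← torusChar_neg, ← torusChar_add,
    sub_eq_add_neg]

/-- **Parseval**: `Σ_q (Ŝ^α_q)ᴴ Ŝ^α_q = L² Σ_x (S^α_x)²` (orthogonality of characters,
`sum_torusChar`). [cite: KLS1988PRL, eq. (2)] -/
private theorem sum_spinMode_conjTranspose_mul (L : ℕ) [NeZero L] (n : ℕ) (α : Fin 3) :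
    ∑ q : TorusSite 2 L, (spinMode L n q α)ᴴ * spinMode L n q α =
      ((L : ℂ) ^ 2) • ∑ x : TorusSite 2 L, siteSpin n x α * siteSpin n x α := by
  simp_rw [spinMode_conjTranspose_mul]
  calc ∑ q : TorusSite 2 L, ∑ x : TorusSite 2 L, ∑ y : TorusSite 2 L,
        (∏ j, (ZMod.stdAddChar (q j * (x - y) j) : ℂ)) • (siteSpin n x α * siteSpin n y α)
      = ∑ x : TorusSite 2 L, ∑ y : TorusSite 2 L,
          (∑ q : TorusSite 2 L, (∏ j, (ZMod.stdAddChar (q j * (x - y) j) : ℂ))) •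
            (siteSpin n x α * siteSpin n y α) := by
        rw [sum_comm]
        refine sum_congr rfl fun x _ => ?_
        rw [sum_comm]
        refine sum_congr rfl fun y _ => ?_
        rw [sum_smul]
    _ = ∑ x : TorusSite 2 L, ((L : ℂ) ^ 2) • (siteSpin n x α * siteSpin n x α) := by
        refine sum_congr rfl fun x _ => ?_
        simp_rw [sum_torusChar, sub_eq_zero, ite_smul, zero_smul]
        rw [sum_ite_eq]
        simp
    _ = _ := by rw [← smul_sum]

/-- `Σ_q C_H(q) = L² Σ_x Re ω((S⁰_x)² + (S¹_x)²)`. [cite: KLS1988PRL, eq. (2)] -/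
private theorem sum_modeWeight (L : ℕ) [NeZero L] (n : ℕ) (H : Op (TorusSite 2 L) (n + 1)) :
    ∑ q : TorusSite 2 L, modeWeight L n H q =
      (L : ℝ) ^ 2 * ∑ x : TorusSite 2 L, (H.groundStateFunctional
        (siteSpin n x 0 * siteSpin n x 0 + siteSpin n x 1 * siteSpin n x 1)).re := by
  unfold modeWeight
  rw [← Complex.re_sum, ← map_sum, sum_add_distrib, sum_spinMode_conjTranspose_mul,
    sum_spinMode_conjTranspose_mul, ← smul_add, ← sum_add_distrib, map_smul, smul_eq_mul,
    show ((L : ℂ) ^ 2) = (((L : ℝ) ^ 2 : ℝ) : ℂ) by push_cast; ring, Complex.re_ofReal_mul,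
    map_sum, Complex.re_sum]

/-- At `q = 0` the mode is the total spin and `C_H(0) = orderSum`. [folklore] -/
private theorem modeWeight_zero (L : ℕ) [NeZero L] (n : ℕ) (H : Op (TorusSite 2 L) (n + 1)) :
    modeWeight L n H 0 = orderSum L n H := by
  have hherm : ∀ (α : Fin 3) (x : TorusSite 2 L), (siteSpin n x α)ᴴ = siteSpin n x α :=
    fun α x => (siteSpin_isHermitian n x α).eq
  have h0 : ∀ α : Fin 3, spinMode L n (0 : TorusSite 2 L) α = ∑ x, siteSpin n x α := by
    intro α
    unfold spinMode
    simp
  have h1 : ∀ α : Fin 3, (spinMode L n (0 : TorusSite 2 L) α)ᴴ * spinMode L n 0 α =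
      ∑ x, ∑ y, siteSpin n x α * siteSpin n y α := by
    intro α
    rw [h0, conjTranspose_sum, sum_mul_sum]
    simp_rw [hherm]
  unfold modeWeight orderSum
  rw [h1, h1, ← sum_add_distrib]
  simp_rw [← sum_add_distrib]
  rw [map_sum, Complex.re_sum]
  simp_rw [map_sum, Complex.re_sum]

/-! ### Loewner bounds from the eigenvalue clause -/

section Loewner

open scoped MatrixOrder

/-- `1 - w ≥ 0` if the Hermitian `w` has all eigenvalues `≤ 1` in absolute value. [folklore] -/
private theorem posSemidef_one_sub_of_eig {m : Type*} [Fintype m] [DecidableEq m]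
    {w : Matrix m m ℂ} (hw : w.IsHermitian) (h : ∀ i, |hw.eigenvalues i| ≤ 1) :
    (1 - w).PosSemidef := by
  have hle : w ≤ algebraMap ℝ (Matrix m m ℂ) 1 := by
    rw [le_algebraMap_iff_spectrum_le (ha := hw.isSelfAdjoint)]
    intro x hx
    rw [hw.spectrum_real_eq_range_eigenvalues] at hx
    obtain ⟨i, rfl⟩ := hx
    exact (abs_le.1 (h i)).2
  rw [map_one] at hle
  exact Matrix.le_iff.1 hle

/-- `1 + w ≥ 0` if the Hermitian `w` has all eigenvalues `≤ 1` in absolute value. [folklore] -/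
private theorem posSemidef_one_add_of_eig {m : Type*} [Fintype m] [DecidableEq m]
    {w : Matrix m m ℂ} (hw : w.IsHermitian) (h : ∀ i, |hw.eigenvalues i| ≤ 1) :
    (1 + w).PosSemidef := by
  have hle : algebraMap ℝ (Matrix m m ℂ) (-1) ≤ w := by
    rw [algebraMap_le_iff_le_spectrum (ha := hw.isSelfAdjoint)]
    intro x hx
    rw [hw.spectrum_real_eq_range_eigenvalues] at hx
    obtain ⟨i, rfl⟩ := hx
    exact (abs_le.1 (h i)).1
  rw [map_neg, map_one] at hle
  have h' := Matrix.le_iff.1 hle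
  rw [sub_neg_eq_add, add_comm] at h'
  exact h'

/-- `|Re ω_A(w)| ≤ 1` for `-1 ≤ w ≤ 1` and the tracial ground state of a Hermitian `A`. [folklore] -/
private theorem abs_re_gsf_le_one {m : Type*} [Fintype m] [DecidableEq m] [Nonempty m]
    {A w : Matrix m m ℂ} (hA : A.IsHermitian) (hw : w.IsHermitian)
    (h : ∀ i, |hw.eigenvalues i| ≤ 1) : |(A.groundStateFunctional w).re| ≤ 1 := by
  have hone := groundStateFunctional_one hA
  have h1 := groundStateFunctional_nonneg_of_posSemidef A (posSemidef_one_sub_of_eig hw h)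
  have h2 := groundStateFunctional_nonneg_of_posSemidef A (posSemidef_one_add_of_eig hw h)
  rw [map_sub, hone] at h1
  rw [map_add, hone] at h2
  obtain ⟨h1, -⟩ := Complex.nonneg_iff.mp h1
  obtain ⟨h2, -⟩ := Complex.nonneg_iff.mp h2
  rw [Complex.sub_re, Complex.one_re] at h1
  rw [Complex.add_re, Complex.one_re] at h2
  rw [abs_le]
  constructor <;> linarith

/-- `|Re ⟨ψ, w ψ⟩| ≤ 1` for `-1 ≤ w ≤ 1` and a unit vector `ψ`. [folklore] -/
private theorem abs_re_rayleigh_le_one {m : Type*} [Fintype m] [DecidableEq m]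
    {w : Matrix m m ℂ} (hw : w.IsHermitian) (h : ∀ i, |hw.eigenvalues i| ≤ 1) (ψ : m → ℂ)
    (hψ : star ψ ⬝ᵥ ψ = 1) : |(star ψ ⬝ᵥ w *ᵥ ψ).re| ≤ 1 := by
  have h1 := (posSemidef_one_sub_of_eig hw h).dotProduct_mulVec_nonneg ψ
  have h2 := (posSemidef_one_add_of_eig hw h).dotProduct_mulVec_nonneg ψ
  rw [sub_mulVec, dotProduct_sub, one_mulVec, hψ] at h1
  rw [add_mulVec, dotProduct_add, one_mulVec, hψ] at h2
  obtain ⟨h1, -⟩ := Complex.nonneg_iff.mp h1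
  obtain ⟨h2, -⟩ := Complex.nonneg_iff.mp h2
  rw [Complex.sub_re, Complex.one_re] at h1
  rw [Complex.add_re, Complex.one_re] at h2
  rw [abs_le]
  constructor <;> linarith

end Loewner

/-! ### Operator AM–GM on a bond -/

/-- `Re ω(b^α_{xy}) ≤ ½ (Re ω((S^α_x)²) + Re ω((S^α_y)²))`, from `(S_x - S_y)ᴴ (S_x - S_y) ≥ 0` and
positivity of the tracial ground state. [folklore] -/
private theorem re_gsf_spinBond_le {Λ : Type*} [Fintype Λ] [DecidableEq Λ] (n : ℕ)
    (A : Op Λ (n + 1)) (α : Fin 3) (x y : Λ) :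
    (A.groundStateFunctional (spinBond n α x y)).re ≤
      ((A.groundStateFunctional (siteSpin n x α * siteSpin n x α)).re +
        (A.groundStateFunctional (siteSpin n y α * siteSpin n y α)).re) / 2 := by
  set Sx : Op Λ (n + 1) := siteSpin n x α with hSx
  set Sy : Op Λ (n + 1) := siteSpin n y α with hSy
  have hpsd : ((Sx - Sy)ᴴ * (Sx - Sy)).PosSemidef := posSemidef_conjTranspose_mul_self _
  have hid : (Sx - Sy)ᴴ * (Sx - Sy) = Sx * Sx + Sy * Sy - (2 : ℂ) • spinBond n α x y := by
    rw [conjTranspose_sub, hSx, hSy, (siteSpin_isHermitian n x α).eq,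
      (siteSpin_isHermitian n y α).eq, spinBond, smul_smul,
      show (2 : ℂ) * (1 / 2) = 1 by norm_num, one_smul]
    simp only [sub_mul, mul_sub]
    abel
  have hnn := groundStateFunctional_nonneg_of_posSemidef A hpsd
  rw [hid, map_sub, map_add, map_smul, smul_eq_mul] at hnn
  obtain ⟨hre, -⟩ := Complex.nonneg_iff.mp hnn
  rw [Complex.sub_re, Complex.add_re] at hre
  have h2 : ((2 : ℂ) * A.groundStateFunctional (spinBond n α x y)).re =
      2 * (A.groundStateFunctional (spinBond n α x y)).re := by
    rw [show (2 : ℂ) = ((2 : ℝ) : ℂ) by norm_num, Complex.re_ofReal_mul]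
  rw [h2] at hre
  linarith

/-! ### The budget -/

/-- **Fourier budget** (stub `stub_fourierBudget` of the line `feynman-sector-gap`). For
`W = Σ_x w_x` with Hermitian rules of spectrum in `[-1,1]` and `H = xyTorus 2 L n + εW` (`L ≥ 3`,
`S = n/2`): `S²L⁴ − |ε|L⁴ ≤ orderSum + Σ_{q≠0} C_H(q)`. Parseval on `(ℤ/Lℤ)²` turns the right side
into `L² Σ_x Re ω((S⁰_x)² + (S¹_x)²)`, which is bounded below through `E₀ = Re ω(H)`, the operator
AM–GM on the `2L²` bonds, `|Re ω(W)| ≤ L²`, and the planar trial state `E₀ ≤ -2S²L² + |ε|L²`.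
[cite: KLS1988PRL, eqs. (2)-(3) and after eq. (8)] -/
theorem stub_fourierBudget :
    ∀ (n L : ℕ) [NeZero L], 1 ≤ n → 3 ≤ L → ∀ (W : Op (TorusSite 2 L) (n + 1)) (ε : ℝ),
      NormBoundedRuleSum n L W →
      ((n : ℝ) / 2) ^ 2 * (L : ℝ) ^ 4 - |ε| * (L : ℝ) ^ 4 ≤
        orderSum L n (hpert L n W ε) +
          ∑ q ∈ (univ : Finset (TorusSite 2 L)).erase 0, modeWeight L n (hpert L n W ε) q := by
  intro n L _ _hn hL W ε hNB
  obtain ⟨w, hWsum, hw⟩ := hNB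
  have hL2 : 2 ≤ L := by omega
  have hL2' : L ≠ 2 := by omega
  -- Hermiticity
  have hWh : W.IsHermitian := by
    rw [hWsum, Matrix.IsHermitian, conjTranspose_sum]
    exact sum_congr rfl fun x _ => (hw x).choose.eq
  set H : Op (TorusSite 2 L) (n + 1) := hpert L n W ε with hHdef
  have hH : H.IsHermitian := by
    rw [hHdef, hpert]
    refine (xyTorus_isHermitian 2 L n).add ?_
    unfold Matrix.IsHermitian
    rw [conjTranspose_smul, hWh.eq, Complex.star_def, Complex.conj_ofReal]
  set ω := H.groundStateFunctional with hω
  -- cardinalities: `|Λ| = L²`, `#E = 2L²`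
  set E := (torusGraph 2 L).edgeFinset with hE
  have hcardT : (Fintype.card (TorusSite 2 L) : ℝ) = (L : ℝ) ^ 2 := by
    rw [Fintype.card_pi, prod_const, ZMod.card, card_univ, Fintype.card_fin]
    push_cast
    ring
  have hcardE : (E.card : ℝ) = 2 * (L : ℝ) ^ 2 := by
    have h5 := sum_pairs_eq_sum_edgeFinset (d := 2) L hL2 (fun _ => (1 : ℝ))
    simp only [sum_const, card_univ, nsmul_eq_mul, mul_one, Fintype.card_fin, if_neg hL2',
      one_mul] at h5
    rw [← hE] at h5
    rw [← hcardT]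
    push_cast at h5 ⊢
    linarith
  -- (1) `|Re ω(W)| ≤ L²`
  have hωW : |(ω W).re| ≤ (L : ℝ) ^ 2 := by
    rw [hWsum, map_sum, Complex.re_sum]
    refine (abs_sum_le_sum_abs _ _).trans ?_
    calc ∑ x : TorusSite 2 L, |(ω (w x)).re| ≤ ∑ x : TorusSite 2 L, (1 : ℝ) :=
          sum_le_sum fun x _ => abs_re_gsf_le_one hH (hw x).choose (hw x).choose_spec
      _ = (L : ℝ) ^ 2 := by rw [sum_const, card_univ, nsmul_eq_mul, mul_one, hcardT]
  -- (2) the bond sum: `-Re ω(xyTorus) ≤ 2 Σ_x f x`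
  set f : TorusSite 2 L → ℝ := fun x =>
    (ω (siteSpin n x 0 * siteSpin n x 0 + siteSpin n x 1 * siteSpin n x 1)).re with hf
  set b : Sym2 (TorusSite 2 L) → Op (TorusSite 2 L) (n + 1) :=
    Sym2.lift ⟨fun x y => spinBond n 0 x y + spinBond n 1 x y + ((0 : ℝ) : ℂ) • spinBond n 2 x y,
      fun x y => by simp only [spinBond_comm]⟩ with hb
  have hxyT : xyTorus 2 L n = ((-1 : ℝ) : ℂ) • ∑ e ∈ E, b e := rfl
  have hbond : ∀ x y : TorusSite 2 L, (ω (b s(x, y))).re ≤ (f x + f y) / 2 := by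
    intro x y
    rw [hb, Sym2.lift_mk, map_add, map_add, map_smul, Complex.ofReal_zero, zero_smul, add_zero,
      Complex.add_re]
    have h0 := re_gsf_spinBond_le n H 0 x y
    have h1 := re_gsf_spinBond_le n H 1 x y
    have hfx : f x = (ω (siteSpin n x 0 * siteSpin n x 0)).re +
        (ω (siteSpin n x 1 * siteSpin n x 1)).re := by
      rw [hf]
      simp only [map_add, Complex.add_re]
    have hfy : f y = (ω (siteSpin n y 0 * siteSpin n y 0)).re +
        (ω (siteSpin n y 1 * siteSpin n y 1)).re := by
      rw [hf]
      simp only [map_add, Complex.add_re]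
    rw [hfx, hfy]
    rw [hω] at *
    linarith
  have hshift : ∀ i : Fin 2, ∑ x : TorusSite 2 L, f (x + Pi.single i 1) = ∑ x, f x := fun i =>
    Equiv.sum_comp (Equiv.addRight (Pi.single i 1 : TorusSite 2 L)) f
  have hxyω : -(ω (xyTorus 2 L n)).re ≤ 2 * ∑ x, f x := by
    rw [hxyT, map_smul, smul_eq_mul, Complex.re_ofReal_mul, map_sum, Complex.re_sum]
    have hpairs := sum_pairs_eq_sum_edgeFinset (d := 2) L hL2 (fun e => (ω (b e)).re)
    rw [if_neg hL2', one_mul, ← hE] at hpairs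
    rw [← hpairs]
    calc -(((-1 : ℝ)) * ∑ x : TorusSite 2 L, ∑ i : Fin 2, (ω (b s(x, x + Pi.single i 1))).re)
        = ∑ x : TorusSite 2 L, ∑ i : Fin 2, (ω (b s(x, x + Pi.single i 1))).re := by ring
      _ ≤ ∑ x : TorusSite 2 L, ∑ i : Fin 2, (f x + f (x + Pi.single i 1)) / 2 :=
          sum_le_sum fun x _ => sum_le_sum fun i _ => hbond x (x + Pi.single i 1)
      _ = 2 * ∑ x, f x := by
          rw [sum_comm]
          simp_rw [add_div, sum_add_distrib, ← sum_div, hshift]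
          rw [sum_const, card_univ, Fintype.card_fin, nsmul_eq_mul]
          push_cast
          ring
  -- (3) the trial state: `E₀ ≤ -2 S² L² + |ε| L²`
  have htrial : H.groundEnergy ≤ -(2 * ((n : ℝ) / 2) ^ 2 * (L : ℝ) ^ 2) + |ε| * (L : ℝ) ^ 2 := by
    obtain ⟨V, hV, hV', hVz, -, hVy⟩ := exists_unitary_conj_spinZ_eq_spinX n
    set U : Op (TorusSite 2 L) (n + 1) := productOp (fun _ : TorusSite 2 L => Vᴴ) with hU
    have hUU : U * Uᴴ = 1 :=
      productOp_mul_conjTranspose fun _ => by rw [conjTranspose_conjTranspose, hV']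
    set v : TensorIndex (TorusSite 2 L) (n + 1) → ℂ := Pi.single (fun _ => 0) 1 with hv
    have hstar : star v = v := by rw [hv, ← Pi.single_star, star_one]
    set ψ := Uᴴ *ᵥ v with hψdef
    have hψ : star ψ ⬝ᵥ ψ = 1 := by
      rw [hψdef, star_mulVec, conjTranspose_conjTranspose, ← dotProduct_mulVec, mulVec_mulVec, hUU,
        one_mulVec, hstar, hv, single_dotProduct, Pi.single_eq_same, one_mul]
    have hray := groundEnergy_le_rayleigh_holds hH ψ hψ
    have hxyψ : star ψ ⬝ᵥ xyTorus 2 L n *ᵥ ψ =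
        -((((n : ℂ) / 2) ^ 2) * (E.card : ℂ)) := by
      rw [hψdef, star_mulVec, conjTranspose_conjTranspose, ← dotProduct_mulVec, mulVec_mulVec,
        mulVec_mulVec, hstar, hv, single_dotProduct, one_mul, mulVec_single_one, Matrix.col_apply,
        hU, xyTorus_trialEnergy L n hV hV' hVz hVy]
    have hWψ : |(star ψ ⬝ᵥ W *ᵥ ψ).re| ≤ (L : ℝ) ^ 2 := by
      rw [hWsum, sum_mulVec, dotProduct_sum, Complex.re_sum]
      refine (abs_sum_le_sum_abs _ _).trans ?_
      calc ∑ x : TorusSite 2 L, |(star ψ ⬝ᵥ w x *ᵥ ψ).re| ≤ ∑ x : TorusSite 2 L, (1 : ℝ) :=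
            sum_le_sum fun x _ => abs_re_rayleigh_le_one (hw x).choose (hw x).choose_spec ψ hψ
        _ = (L : ℝ) ^ 2 := by rw [sum_const, card_univ, nsmul_eq_mul, mul_one, hcardT]
    have hsplit : (star ψ ⬝ᵥ H *ᵥ ψ).re =
        -(((n : ℝ) / 2) ^ 2 * (2 * (L : ℝ) ^ 2)) + ε * (star ψ ⬝ᵥ W *ᵥ ψ).re := by
      rw [hHdef, hpert, add_mulVec, dotProduct_add, smul_mulVec, dotProduct_smul, smul_eq_mul,
        hxyψ, Complex.add_re, Complex.re_ofReal_mul, ← hcardE, Complex.neg_re,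
        show (((n : ℂ) / 2) ^ 2 * (E.card : ℂ)) = ((((n : ℝ) / 2) ^ 2 * (E.card : ℝ) : ℝ) : ℂ) by
          push_cast; ring, Complex.ofReal_re]
    rw [hsplit] at hray
    have hεW : ε * (star ψ ⬝ᵥ W *ᵥ ψ).re ≤ |ε| * (L : ℝ) ^ 2 := by
      calc ε * (star ψ ⬝ᵥ W *ᵥ ψ).re ≤ |ε * (star ψ ⬝ᵥ W *ᵥ ψ).re| := le_abs_self _
        _ = |ε| * |(star ψ ⬝ᵥ W *ᵥ ψ).re| := abs_mul _ _
        _ ≤ |ε| * (L : ℝ) ^ 2 := mul_le_mul_of_nonneg_left hWψ (abs_nonneg ε)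
    linarith
  -- (4) `E₀ = Re ω(H) = Re ω(xyTorus) + ε Re ω(W)`
  have hE0 : H.groundEnergy = (ω (xyTorus 2 L n)).re + ε * (ω W).re := by
    have h := congrArg Complex.re (groundStateFunctional_hamiltonian hH)
    rw [Complex.ofReal_re] at h
    rw [← h, ← hω]
    conv_lhs => rw [hHdef, hpert]
    rw [map_add, map_smul, smul_eq_mul, Complex.add_re, Complex.re_ofReal_mul]
  have hεω : -(|ε| * (L : ℝ) ^ 2) ≤ ε * (ω W).re := by
    have h1 : |ε * (ω W).re| ≤ |ε| * (L : ℝ) ^ 2 := by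
      rw [abs_mul]
      exact mul_le_mul_of_nonneg_left hωW (abs_nonneg ε)
    linarith [neg_abs_le (ε * (ω W).re)]
  -- (5) combine
  have key : ((n : ℝ) / 2) ^ 2 * (L : ℝ) ^ 2 - |ε| * (L : ℝ) ^ 2 ≤ ∑ x, f x := by linarith
  have hL2nn : (0 : ℝ) ≤ (L : ℝ) ^ 2 := by positivity
  calc ((n : ℝ) / 2) ^ 2 * (L : ℝ) ^ 4 - |ε| * (L : ℝ) ^ 4
      = (L : ℝ) ^ 2 * (((n : ℝ) / 2) ^ 2 * (L : ℝ) ^ 2 - |ε| * (L : ℝ) ^ 2) := by ring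
    _ ≤ (L : ℝ) ^ 2 * ∑ x, f x := mul_le_mul_of_nonneg_left key hL2nn
    _ = ∑ q : TorusSite 2 L, modeWeight L n H q := (sum_modeWeight L n H).symm
    _ = orderSum L n H + ∑ q ∈ (univ : Finset (TorusSite 2 L)).erase 0, modeWeight L n H q := by
        rw [← add_sum_erase _ _ (mem_univ (0 : TorusSite 2 L)), modeWeight_zero]

end Summit.HubbardSuperconductivity.HubbardSuperconductivity.Theorems.XYOrderOpennessLargeSpin

end
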